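import Mathlib
import Summits.Ventures.HodgeRepro2.Tier7.Line3.KappaDataFinLocalSplit

/-!
# Tier 7 — LINE 3 support: the split-place data of the finite side, packaged (`Line3/FinKappaOfLocalSplit.lean`;
t7-L1-p5, gen 3; the split-place companion of x1's `LocalData` (FinKappaOfLocalData, v2 of p686554 after crit-2's
OBJECTION (H), STATUS l. 15569))

x1's `LocalData` packages the local torus-translate data of the NON-split finite places and DISPLAYS the two κ-level
clauses of the split places (`hS_split : ∀ N γ, arith N γ → ∀ w ∈ S, w ∈ Sp → w (κF γ − κF γ₀) ≤ M w ^ 6` and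
`hout_split : ∀ N γ, arith N γ → ∀ w ∈ Sp, w ∉ S → w (κF γ − κF γ₀) ≤ 1`), because at a split place the local algebra
`E ⊗ K_w ≅ K_w × K_w` is not a field and the non-split shape is unsatisfiable there. **`SplitLocal`** packages the
local data of the split places in the two-component picture of `KappaDataFinLocalSplit` (p687119): for every `w` in the
SET `Sp` of split places (infinite for the real objects) a completion-type `Kw w` (a parameter, with its field structure;
no instance is declared), the two conjugate embeddings `ψ₁ w, ψ₂ w : E →+* Kw w` (`ψ₂ = ψ₁ ∘ σ`), ONE absolute value
`abv w` of `Kw w` above `w`, the integrality of the adapted data off `S`, the entry bounds `Ms w` at `S`, and the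
support clauses on LOCAL torus translates of the pair `(ψ₁(matO γ), ψ₂(matO γ))` (`IsTranslateSplit`), and PROVES
the two displayed clauses in `LocalData`'s exact binder shapes:
* **`SplitLocal.hout_split`** (from `hout_field_local_split`), **`SplitLocal.hS_split_disc`** (the bound
  `Ms w ^ 6 / |d₁₀ d′₀|_w`, from `hS_field_local_split`) and **`SplitLocal.hS_split`** (the `M w ^ 6` shape, through the
  displayed compatibility `hMcomp : Ms w ^ 6 / |d₁₀ d′₀|_w ≤ M w ^ 6` at `S ∩ Sp` — `M w` is free at the split places
  of `LocalData`, where it enters only `hS_split`, so the consumer takes `M w` at least the sixth root of the split bound).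
So a `LocalData` with `hS_split := D.hS_split` and `hout_split := D.hout_split` (`D : SplitLocal … S Sp M`) has NO
displayed split clause: its `toFinKappa` reads every finite clause of `FinKappa` from a local torus-translate condition —
the non-split places and `v₁` through `KappaDataFinLocal` (p685687), the split places through `KappaDataFinLocalSplit`
(p687119). `S`, `Sp`, `M` are PARAMETERS of `SplitLocal` (the ones of the `LocalData` it completes). What stays in words:
that the real `K_w` at a split `w` IS the pair of integral matrices in the adapted coordinates of the two components, and
the choice of `ψ₁ w`, `ψ₂ w`, `abv w` above `w` (the dictionary). Nothing about periods or (N). Pure bookkeeping.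
Sorry-free; axioms: propext / Classical.choice / Quot.sound. §8(d): uses an L-value-free non-vanishing device: NO.
-/

namespace Summit.Ventures.HodgeRepro2.Tier7.Line3.KappaDataFinLocalSplit

open NumberField Matrix Summit.Ventures.HodgeRepro2.T7SupportTwoTorusInvariant

/-- **THE SPLIT-PLACE LOCAL DATA** of the finite side: at every place `w` of the set `Sp` (split in `E / K`) the two
conjugate embeddings into the completion-type `Kw w`, one absolute value above `w`, the local adapted data in the two
components and the support clauses on local torus translates of `(ψ₁(matO γ), ψ₂(matO γ))`; `S` (bounded
denominators), `Sp` (split places) and `M` (the size parameter of the `LocalData` it completes) are parameters. -/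
structure SplitLocal {E K Orb : Type} [Field E] [Field K] [NumberField K] [Algebra K E]
    (Kw : FinitePlace K → Type) [∀ w, Field (Kw w)] (σ : E →+* E)
    (d : Fin 2 → E) (f : Fin 2 → Fin 2 → E) (matO : Orb → Matrix (Fin 2) (Fin 2) E) (κF : Orb → K)
    (arith : ℕ → Orb → Prop) (γ₀ : Orb) (S : Finset (FinitePlace K)) (Sp : Set (FinitePlace K))
    (M : FinitePlace K → ℝ) where
  /-- the descent identity -/
  hκF : ∀ γ, algebraMap K E (κF γ) = kappa σ d f (matO γ)
  /-- the first embedding of `E` into the completion at `w` -/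
  ψ₁ : ∀ w, E →+* Kw w
  /-- the second (conjugate) embedding -/
  ψ₂ : ∀ w, E →+* Kw w
  /-- the absolute value of the completion above `w` -/
  abv : ∀ w, AbsoluteValue (Kw w) ℝ
  /-- the two embeddings above a split place are conjugate -/
  hψ : ∀ w ∈ Sp, ∀ x, ψ₂ w x = ψ₁ w (σ x)
  /-- the absolute value restricts to `|·|_w` on `K` -/
  habv : ∀ w ∈ Sp, ∀ x : K, w x = abv w (ψ₁ w (algebraMap K E x))
  hna : ∀ w ∈ Sp, IsNonarchimedean (abv w)
  /-- integrality of the local adapted data, in both components, at the split places off `S` -/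
  hf₁_int : ∀ w ∈ Sp, w ∉ S → ∀ i, abv w (ψ₁ w (f 0 i)) ≤ 1
  hf₂_int : ∀ w ∈ Sp, w ∉ S → ∀ i, abv w (ψ₂ w (f 0 i)) ≤ 1
  hd₁_int : ∀ w ∈ Sp, w ∉ S → abv w (ψ₁ w (d 0)) ≤ 1
  hd₂_int : ∀ w ∈ Sp, w ∉ S → abv w (ψ₂ w (d 0)) ≤ 1
  hdisc_unit : ∀ w ∈ Sp, w ∉ S →
    abv w (ψ₁ w (d 0) * discSplit (fun i => ψ₁ w (d i)) (fun j i => ψ₁ w (f j i)) (fun j i => ψ₂ w (f j i)) 0) = 1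
  /-- some local torus translate of `γ₀` is integral in both components at the split places off `S` -/
  hγ₀_int : ∀ w ∈ Sp, w ∉ S → ∃ m₁ m₂, IsTranslateSplit (fun j i => ψ₁ w (f j i)) (fun j i => ψ₂ w (f j i))
    ((matO γ₀).map (ψ₁ w)) ((matO γ₀).map (ψ₂ w)) m₁ m₂ ∧
    (∀ i j, abv w (m₁ i j) ≤ 1) ∧ ∀ i j, abv w (m₂ i j) ≤ 1
  /-- on the support, some local torus translate is integral in both components at the split places off `S` -/
  hsupp_int : ∀ w ∈ Sp, w ∉ S → ∀ N γ, arith N γ → ∃ m₁ m₂,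
    IsTranslateSplit (fun j i => ψ₁ w (f j i)) (fun j i => ψ₂ w (f j i))
      ((matO γ).map (ψ₁ w)) ((matO γ).map (ψ₂ w)) m₁ m₂ ∧
    (∀ i j, abv w (m₁ i j) ≤ 1) ∧ ∀ i j, abv w (m₂ i j) ≤ 1
  /-- the entry bounds at the split places of `S` -/
  Ms : FinitePlace K → ℝ
  hMs : ∀ w ∈ S, w ∈ Sp → 0 ≤ Ms w
  hf₁_S : ∀ w ∈ S, w ∈ Sp → ∀ i, abv w (ψ₁ w (f 0 i)) ≤ Ms w
  hf₂_S : ∀ w ∈ S, w ∈ Sp → ∀ i, abv w (ψ₂ w (f 0 i)) ≤ Ms w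
  hd₁_S : ∀ w ∈ S, w ∈ Sp → abv w (ψ₁ w (d 0)) ≤ Ms w
  hd₂_S : ∀ w ∈ S, w ∈ Sp → abv w (ψ₂ w (d 0)) ≤ Ms w
  hγ₀_S : ∀ w ∈ S, w ∈ Sp → ∃ m₁ m₂, IsTranslateSplit (fun j i => ψ₁ w (f j i)) (fun j i => ψ₂ w (f j i))
    ((matO γ₀).map (ψ₁ w)) ((matO γ₀).map (ψ₂ w)) m₁ m₂ ∧
    (∀ i j, abv w (m₁ i j) ≤ Ms w) ∧ ∀ i j, abv w (m₂ i j) ≤ Ms w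
  hsupp_S : ∀ w ∈ S, w ∈ Sp → ∀ N γ, arith N γ → ∃ m₁ m₂,
    IsTranslateSplit (fun j i => ψ₁ w (f j i)) (fun j i => ψ₂ w (f j i))
      ((matO γ).map (ψ₁ w)) ((matO γ).map (ψ₂ w)) m₁ m₂ ∧
    (∀ i j, abv w (m₁ i j) ≤ Ms w) ∧ ∀ i j, abv w (m₂ i j) ≤ Ms w
  /-- the size parameter `M` of the completed `LocalData` dominates the split bound at `S ∩ Sp` (displayed; `M w` is
  free there — the consumer takes it at least the sixth root of `Ms w ^ 6 / |d₁₀ d′₀|_w`) -/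
  hMcomp : ∀ w ∈ S, w ∈ Sp →
    Ms w ^ 6 / abv w (ψ₁ w (d 0) *
      discSplit (fun i => ψ₁ w (d i)) (fun j i => ψ₁ w (f j i)) (fun j i => ψ₂ w (f j i)) 0) ≤ M w ^ 6

namespace SplitLocal

variable {E K Orb : Type} [Field E] [Field K] [NumberField K] [Algebra K E] {Kw : FinitePlace K → Type}
  [∀ w, Field (Kw w)] {σ : E →+* E} {d : Fin 2 → E} {f : Fin 2 → Fin 2 → E}
  {matO : Orb → Matrix (Fin 2) (Fin 2) E} {κF : Orb → K} {arith : ℕ → Orb → Prop} {γ₀ : Orb}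
  {S : Finset (FinitePlace K)} {Sp : Set (FinitePlace K)} {M : FinitePlace K → ℝ}
  (D : SplitLocal Kw σ d f matO κF arith γ₀ S Sp M)

include D

/-- **`LocalData.hout_split` from the split local data**: integrality of `κF γ − κF γ₀` at the split places off `S`,
on the support (`hout_field_local_split` at each `w ∈ Sp ∖ S`) -/
theorem hout_split : ∀ N γ, arith N γ → ∀ w ∈ Sp, w ∉ S → w (κF γ - κF γ₀) ≤ 1 := fun N γ hγ w hw hS =>
  hout_field_local_split (D.abv w) σ (D.ψ₁ w) (D.ψ₂ w) d f matO κF w arith γ₀ (D.hψ w hw) (D.habv w hw)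
    D.hκF (D.hna w hw) (D.hf₁_int w hw hS) (D.hf₂_int w hw hS) (D.hd₁_int w hw hS) (D.hd₂_int w hw hS)
    (D.hdisc_unit w hw hS) (D.hγ₀_int w hw hS) (D.hsupp_int w hw hS) N γ hγ

/-- the split bound at `S ∩ Sp` with its discriminant denominator (`hS_field_local_split` at each `w ∈ S ∩ Sp`) -/
theorem hS_split_disc : ∀ N γ, arith N γ → ∀ w ∈ S, w ∈ Sp → w (κF γ - κF γ₀) ≤
    D.Ms w ^ 6 / D.abv w (D.ψ₁ w (d 0) *
      discSplit (fun i => D.ψ₁ w (d i)) (fun j i => D.ψ₁ w (f j i)) (fun j i => D.ψ₂ w (f j i)) 0) :=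
  fun N γ hγ w hS hw =>
  hS_field_local_split (D.abv w) σ (D.ψ₁ w) (D.ψ₂ w) d f matO κF w arith γ₀ (D.hψ w hw) (D.habv w hw)
    D.hκF (D.hna w hw) (D.hMs w hS hw) (D.hf₁_S w hS hw) (D.hf₂_S w hS hw) (D.hd₁_S w hS hw) (D.hd₂_S w hS hw)
    (D.hγ₀_S w hS hw) (D.hsupp_S w hS hw) N γ hγ

/-- **`LocalData.hS_split` from the split local data**: the bound `M w ^ 6` at `S ∩ Sp` on the support -/
theorem hS_split : ∀ N γ, arith N γ → ∀ w ∈ S, w ∈ Sp → w (κF γ - κF γ₀) ≤ M w ^ 6 :=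
  fun N γ hγ w hS hw => (D.hS_split_disc N γ hγ w hS hw).trans (D.hMcomp w hS hw)

end SplitLocal

end Summit.Ventures.HodgeRepro2.Tier7.Line3.KappaDataFinLocalSplit
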